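import Summits.BirchSwinnertonDyer.BirchSwinnertonDyer.Theorems.AdditiveBranchIMCMultLowerCycLineGrossZagierOdd
import Summits.BirchSwinnertonDyer.BirchSwinnertonDyer.Theorems.AdditiveBranchIMCMultLowerCycLineTwistData
import Summits.BirchSwinnertonDyer.BirchSwinnertonDyer.Theorems.AdditiveBranchIMCMultLowerRankOneClassCert
import Summits.BirchSwinnertonDyer.Rank1Residual.Additive.DisegniLineEndState
import HarnessLib

/-!
# Route `AdditiveBranchIMC` (rung K1), crux `MultLower` (item 19359), cell (M): the KERNEL END STATE —
# on (M), in analytic rank one, Delbourgo's datum with the typed (M) `p`-adic Gross–Zagier for EVERY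
# admissible tuple and EVERY (B)-datum, from PRINTED facts (Disegni's conjoined fact (B) `hCyc` + GZ86
# I.(7.3) + Waldspurger + modularity); items 19592 / 19591 and the §C glue with hFact REPLACED by print

Cell `bsd-addord`, seat `bsd-addord-k1-c4` (gen 4). THEOREMS ONLY (no definition, no named fact, no
`sorry`). This is the (M) analogue of gz's `DisegniLineEndState*`: hFact
(`Disegni2017.delbourgoDatum_rankOne_leadingTerms`, the cell-memo fact used by this seat's
`…RegulatorRigidity` / `…RankOneClassCert`) is REPLACED by lit's conjoined named fact (B)
`hCyc : Disegni2017.delbourgoDatum_cycLineGrossZagier` (Disegni 2017 Thm. A on the cyclotomic line ∧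
Thm. B ÷ YZZ (1.1.3) at `𝟙_K` ∧ Delbourgo 2002 Thm. (B) for ONE datum; PRINTED; its (M) clause `Mult V p ∧
α = a_p(V)` is exactly what is consumed), `h73 : GrossZagier1986_thm_I_7_3`, `hWald :
waldspurger_exists_heegnerField_twist_ne_zero`, `hmodN : exists_isNewformOf`, together with the binders
already present (`hDelM`, `hmod`, `hmodD`, `hGZK`). Artin formalism (`hArt`) and Pal 2012 Thm. 3.2 are tree
THEOREMS (`rankinSelbergEulerProductHecke_baseChangeDirichlet_eq_holds`,
`Pal2012.thm32_sqrt_mul_realPeriodRat_twist_eq_of_prime_one_mod_four_holds`) and are discharged here.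
TUPLE and DATUM universality by REGULATOR RIGIDITY: gz's kernel road derives the identity at ONE tuple `(V, f, ϖ)` and re-keys the consumers (memo §4: «the
universal predicate is NOT derived»). On (M) we obtain the universal predicate: for EVERY admissible tuple
`t = (V, C, f, B, ϖ)` of `BranchPAdicGrossZagierMultAt W p Dh₀`, the fact (B) supplies a (B)-datum `Dh_t`
(depending on `t` through `V, C`) with the identity at `t` for `Dh_t` (§1, the (M) kernel twin of STEP
A–C: `branchPAdicGrossZagierMult_identity_of_cycLine[_odd]` over `exists_twist_newform_mult`), and
REGULATOR RIGIDITY (`exists_unit_padicRegulator_eq_of_leadingTermClauses`: (A)-torsion from `hDelM`, `Ш`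
finite from GZK, `ℓ_p = 1` on (M)) moves it to the fixed datum `Dh₀` up to a unit. So (§2)
`potMult_exists_leadingTermClauses_and_branchPAdicGrossZagierMultAt_of_cycLineFact :
∃ Dh, LeadingTermClauses W p Dh ∧ BranchPAdicGrossZagierMultAt W p Dh`, and then EVERY (B)-datum
(`potMult_branchPAdicGrossZagierMultAt_of_one_datum`).

Consequences (§3): **ITEM 19592 BY NAME from PRINTED facts** (`multBranchPAdicGrossZagierAt_of_cycLineFact :
hCyc → h73 → hWald → hmodN → hmod → hmodD → GZK → Delbourgo2002.mainTheorem_potMult →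
MultBranchPAdicGrossZagierAt`; no certificate, no image hypothesis, `p = 3` included); Schneider from the
typed identity + the census bit; **ITEM 19591 BY NAME** (`multSchneiderNondegeneracy_of_cycLineFact_of_classCert`,
printed facts + the (M) class certificate); the **§C v4 GLUE**
`multLower_of_facts_of_cycLineFact_of_multLambdaLower_of_classCert : DelbourgoPotMultUnit →
PalQuadraticTwistPeriod → DelbourgoLeadingTermPotMult → MultModularityInputs → hCyc → h73 → hWald → hmodN →
MultLambdaLower → (class certificate) → MultLower`.

HONEST LABELS: conditional helper theorems; the named facts are PRINTED theorems entered by name; REFEREE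
CONDITION GZ-H binds (the height identification inside `hCyc` is Disegni 2017 Rem. 1.3.2 + Disegni 2022
Thm. B context, (n-exc) discharged by `ε_p` ramified, also for SPLIT multiplicative `V`; Nekovář 1993 §7.14
unheld, acq-10827); 19590 is NOT in print; the class certificate is per-pair EVIDENCE. Nothing booked.
References: [Disegni2017] Thm. A/B, (1.1.3), Rem. 1.3.2; [Delbourgo2002] Thm. (A), (B), p. 39;
[GrossZagier1986] Thm. I.(7.3); [Pal2012] Thm. 3.2; [MazurTateTeitelbaum1986Invent] §I.8, §I.10, §I.13–I.14.
-/

set_option autoImplicit false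
set_option linter.dupNamespace false

noncomputable section

open scoped Classical MatrixGroups ModularForm NumberField

namespace Summit.BirchSwinnertonDyer.BirchSwinnertonDyer.Theorems.AdditiveBranchIMCMultLower

open CongruenceSubgroup WeierstrassCurve NumberField Literature.NumberTheory.EllipticCurves
  Literature.NumberTheory.EllipticCurves.ModularForms Literature.NumberTheory.EllipticCurves.Rank1Residual
  Literature.NumberTheory.EllipticCurves.Rank1Residual.Typed
  Literature.NumberTheory.EllipticCurves.Delbourgo2002
  Literature.NumberTheory.EllipticCurves.Disegni2017 Literature.NumberTheory.QuadraticFields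
  Literature.NumberTheory.GaloisRepresentations
  Summit.BirchSwinnertonDyer.Rank1Residual.Additive
  Summit.BirchSwinnertonDyer.Rank1Residual.AdditivePotMult
  Summit.BirchSwinnertonDyer.BirchSwinnertonDyer.Theses.AdditiveBranchIMC

variable {W : WeierstrassCurve ℚ} {p : ℕ} [hp : Fact p.Prime]

/-! ### §0 Sign/parity bookkeeping: the disjunct `B` of `BranchPAdicGrossZagierMultAt` is the one-term
branch at `a_p(V)` -/

/-- The branch series `B` named by the (M) disjunction of `BranchPAdicGrossZagierMultAt` is
`L^±_p(f, a_p(V), ω^{(p−1)/2}, T)` with the sign read as `a_p(V) = V.LFunction p` (`= 1` split, `= −1`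
non-split: `IsNewformOf.cuspCoeff_eq_one_and_sq_of_split` / `…_eq_neg_one_and_dvd_of_nonsplit`).
[cite: MazurTateTeitelbaum1986Invent, §I.10 (10.1), §I.13] -/
theorem multBranch_eq_ite_of_disj (V : WeierstrassCurve ℚ) [V.IsElliptic]
    [V.IsGloballyMinimal] {N : ℕ} [NeZero N] {f : CuspForm (Gamma0 N) 2} (hf : IsNewformOf V f)
    {B : PowerSeries ℚ_[p]}
    (hVB : (V.HasSplitMultiplicativeReductionAtPrime p ∧
        B = if Even (p / 2) then padicLFunctionPlusBranchMult f (1 : ℚ_[p]) (p / 2)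
          else padicLFunctionMinusBranchMult f (1 : ℚ_[p]) (p / 2)) ∨
      (V.HasMultiplicativeReductionAtPrime p ∧ ¬ V.HasSplitMultiplicativeReductionAtPrime p ∧
        B = if Even (p / 2) then padicLFunctionPlusBranchMult f (-1 : ℚ_[p]) (p / 2)
          else padicLFunctionMinusBranchMult f (-1 : ℚ_[p]) (p / 2))) :
    Mult V p ∧
      B = if Even (p / 2) then padicLFunctionPlusBranchMult f ((V.LFunction p : ℤ) : ℚ_[p]) (p / 2)
        else padicLFunctionMinusBranchMult f ((V.LFunction p : ℤ) : ℚ_[p]) (p / 2) := by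
  rcases hVB with ⟨hs, hB⟩ | ⟨hm, hns, hB⟩
  · have h1 := (hf.cuspCoeff_eq_one_and_sq_of_split hs).1
    rw [hf.2 p] at h1
    have h1' : (V.LFunction p : ℤ) = 1 := by exact_mod_cast h1
    refine ⟨hs.hasMultiplicativeReductionAtPrime, ?_⟩
    rw [hB, h1']; push_cast; rfl
  · have h1 := (hf.cuspCoeff_eq_neg_one_and_dvd_of_nonsplit hm hns).1
    rw [hf.2 p] at h1
    have h1' : (V.LFunction p : ℤ) = -1 := by exact_mod_cast h1
    refine ⟨hm, ?_⟩
    rw [hB, h1']; push_cast; rfl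

/-! ### §1 The identity at ANY admissible tuple, for the datum the fact (B) attaches to that tuple -/

/-- **The (M) kernel twin of STEP A–C at an arbitrary admissible tuple.** `W` globally minimal, `p` odd,
`PotMult W p`, `r_an = 1`; a multiplicative twist model `C • V^{(p*)} = W` with newform `f`, the branch
`B` of the disjunction and a period ratio `ϖ` of the parity of `(p−1)/2`. From `hCyc` (at the Heegner field
`K` of `hWald`, any `ι`, the newform `f_E` of `hmodD W`), `h73`, modularity, GZK: there is a (B)-datum `Dh`
(the one (B) attaches to `(K, ι, V, C, f_E)`) with `L′(E,1) = q·Ω_E·Reg_∞` and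
`ϖ·[T¹]B·log_p γ = u·q·Reg_p(E,Dh)`. Both parities (`branchPAdicGrossZagierMult_identity_of_cycLine[_odd]`
over `exists_twist_newform_mult` and gz's `legendre{Plus,Minus}SymbolSum_ne_zero_of_twist`).
[cite: Disegni2017, Theorem A/B, (1.1.3), Rem. 1.3.2] [cite: Delbourgo2002, Theorem (B) (p. 40), Hypothesis (p. 39)]
[cite: GrossZagier1986, Thm. I.(7.3)] [cite: MazurTateTeitelbaum1986Invent, §I.10, §I.13–I.14] -/
theorem potMult_exists_leadingTermClauses_and_identity_of_cycLineFact [W.IsElliptic] [W.IsGloballyMinimal]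
    (hCyc : delbourgoDatum_cycLineGrossZagier) (h73 : GrossZagier1986_thm_I_7_3)
    (hWald : waldspurger_exists_heegnerField_twist_ne_zero) (hmodN : exists_isNewformOf)
    (hmod : hasEntireLFunction_rat) (hmodD : nonempty_modularParametrizationData)
    (hGZK : rank_eq_analyticRank_of_analyticRank_le_one)
    (hpm : Summit.BirchSwinnertonDyer.Rank1Residual.AdditivePotMult.PotMult W p) (hp2 : p ≠ 2)
    (hr : W.analyticRank = 1)
    (V : WeierstrassCurve ℚ) [V.IsElliptic] [V.IsGloballyMinimal] (C : VariableChange ℚ)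
    (hC : C • V.quadraticTwist ((-1 : ℚ) ^ (p / 2) * p) = W)
    {N : ℕ} [NeZero N] {f : CuspForm (Gamma0 N) 2} (hf : IsNewformOf V f) (B : PowerSeries ℚ_[p])
    (hVB : (V.HasSplitMultiplicativeReductionAtPrime p ∧
        B = if Even (p / 2) then padicLFunctionPlusBranchMult f (1 : ℚ_[p]) (p / 2)
          else padicLFunctionMinusBranchMult f (1 : ℚ_[p]) (p / 2)) ∨
      (V.HasMultiplicativeReductionAtPrime p ∧ ¬ V.HasSplitMultiplicativeReductionAtPrime p ∧
        B = if Even (p / 2) then padicLFunctionPlusBranchMult f (-1 : ℚ_[p]) (p / 2)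
          else padicLFunctionMinusBranchMult f (-1 : ℚ_[p]) (p / 2)))
    (ϖ : ℚ) (hϖ : if Even (p / 2) then (ϖ : ℝ) * V.realPeriodRat = plusPeriod f
      else (ϖ : ℝ) * V.imaginaryPeriodRat = minusPeriod f) :
    ∃ (Dh : PAdicHeightData W p) (u : ℤ_[p]ˣ) (q : ℚ), LeadingTermClauses W p Dh ∧
      W.leadingLCoeff = (q : ℂ) * (W.realPeriodRat : ℂ) * (W.regulator : ℂ) ∧
      (ϖ : ℚ_[p]) * PowerSeries.coeff 1 B * padicLog p (cyclotomicGenerator p) =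
        ((u : ℤ_[p]) : ℚ_[p]) * (q : ℚ_[p]) * padicRegulator Dh := by
  have hpP : p.Prime := hp.out
  have hodd : p % 4 = 1 ∨ p % 4 = 3 := by
    obtain ⟨k, hk⟩ := hpP.odd_of_ne_two hp2
    omega
  obtain ⟨hV, hBeq⟩ := multBranch_eq_ite_of_disj V hf hVB
  -- the newform of `E`
  haveI : NeZero (W.conductorNorm ℤ) := ⟨(W.conductorNorm_pos_holds).ne'⟩
  obtain ⟨DmW⟩ := hmodD W
  -- the Heegner field with `L(E^{(d_K)}, 1) ≠ 0` (Waldspurger)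
  have hroot : W.rootNumber = -1 := by
    rcases rootNumber_eq_one_or_eq_neg_one W with h1 | h1
    · exfalso
      have hev1 : Even W.analyticRank :=
        (even_analyticRank_iff_rootNumber_eq_one_of_exists_isNewformOf W hmodN).mpr h1
      rw [hr] at hev1
      exact Nat.not_even_one hev1
    · exact h1
  obtain ⟨K, _, _, hK, -, hHeeg, hLd⟩ := hWald W hroot 0
  have h2 : Module.finrank ℚ K = 2 := hK.1
  haveI : IsGalois ℚ K := isGalois_of_finrank_eq_two K h2
  have hdq : (NumberField.discr K : ℚ) ≠ 0 := by exact_mod_cast NumberField.discr_ne_zero K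
  -- the Kronecker character and the multiplicative twist data
  obtain ⟨κ, hκ, hκ2, hκall⟩ := exists_kroneckerChar_twistCoeff K h2
  obtain ⟨hpd, hκW, V', iV', iVm', N', _, f', hfV', hV', hap, hV'm⟩ :=
    exists_twist_newform_mult K hmodD hp2 h2 κ hκ hκall hHeeg hpm.1 V C hC hV hf
  have hpdN : Nat.Coprime p (NumberField.discr K).natAbs :=
    (Nat.Prime.coprime_iff_not_dvd hpP).mpr fun h ↦ hpd (Int.natCast_dvd.mpr h)
  have hrd : (W.quadraticTwist (NumberField.discr K : ℚ)).mordellWeilRank = 0 := by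
    haveI := W.isElliptic_quadraticTwist hdq
    have h0 : (W.quadraticTwist (NumberField.discr K : ℚ)).analyticRank = 0 :=
      (analyticRank_eq_zero_iff_holds (hmod _)).mpr hLd
    rw [(hGZK _ (by rw [h0]; exact zero_le_one)).1, h0]
  -- the datum: lit's conjoined fact (B) at `(K, ι, V, C, f_E, α = a_p(V))`
  obtain ⟨ι⟩ := PadicAlgCl.nonempty_ringEquiv_complex (p := p)
  have hpstar : ((pStar p : ℤ) : ℚ) = (-1 : ℚ) ^ (p / 2) * p := by
    rw [pStar, show (p - 1) / 2 = p / 2 by omega]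
    push_cast
    ring
  have hCps : C • V.quadraticTwist (pStar p : ℚ) = W := by rw [hpstar]; exact hC
  obtain ⟨Dh, DhK, hres, hBcl, hGZc⟩ := hCyc.exists_datum ι hp2 hpm.not_hasCM hpm.1 hr
    (delbourgo2002PrintedHypotheses_of_potMult hpm.2 (hpm.exists_quadraticTwist_mult hp2)) hCps
    (Or.inr ⟨hV, rfl⟩) DmW.isNewformOf hK hHeeg
  rcases hodd with h1 | h3
  · -- EVEN branch
    have hev : Even (p / 2) := ⟨p / 4, by omega⟩
    rw [if_pos hev] at hϖ hBeq
    have hC' : C • V.quadraticTwist (p : ℚ) = W := by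
      rw [pStar_eq_self_of_mod_four_eq_one h1] at hC; exact hC
    have hS' : legendrePlusSymbolSum f' p ≠ 0 :=
      legendrePlusSymbolSum_ne_zero_of_twist K hmod h1 κ hκW hpm.1 V ⟨C, hC'⟩ hf hfV'.1
        hfV'.coeffField_eq_bot hV' hLd
    obtain ⟨u, q, hlead, hpgz⟩ := branchPAdicGrossZagierMult_identity_of_cycLine ι K h1
      rankinSelbergEulerProductHecke_baseChangeDirichlet_eq_holds h73
      Pal2012.thm32_sqrt_mul_realPeriodRat_twist_eq_of_prime_one_mod_four_holds hmod hGZK h2 κ hκ hκ2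
      hpdN hrd hpm.1 hr V V' C hC' hV hV'm hap hf DmW.isNewformOf hfV' hV' hS' ϖ hϖ hres hGZc
    exact ⟨Dh, u, q, hBcl, hlead, by rw [hBeq]; exact hpgz⟩
  · -- ODD branch
    have hne : ¬ Even (p / 2) := by rw [Nat.not_even_iff_odd]; exact ⟨p / 4, by omega⟩
    rw [if_neg hne] at hϖ hBeq
    have hC' : C • V.quadraticTwist (-(p : ℚ)) = W := by
      rw [pStar_eq_neg_of_mod_four_eq_three h3] at hC; exact hC
    have hS' : legendreMinusSymbolSum f' p ≠ 0 :=
      legendreMinusSymbolSum_ne_zero_of_twist K hmod h3 κ hκW hpm.1 V ⟨C, hC'⟩ hf hfV'.1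
        hfV'.coeffField_eq_bot hV' hLd
    obtain ⟨u, q, hlead, hpgz⟩ := branchPAdicGrossZagierMult_identity_of_cycLine_odd ι K h3
      rankinSelbergEulerProductHecke_baseChangeDirichlet_eq_holds h73 hmod hGZK h2 κ hκ hκ2
      hpdN hrd hpm.1 hr V V' C hC' hV hV'm hap hf DmW.isNewformOf hfV' hV' hS' ϖ hϖ hres hGZc
    exact ⟨Dh, u, q, hBcl, hlead, by rw [hBeq]; exact hpgz⟩

/-! ### §2 ONE datum for EVERY tuple (rigidity), hence the typed (M) `p`-adic Gross–Zagier -/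

/-- **(M), `r_an = 1`: Delbourgo's datum with the typed (M) `p`-adic Gross–Zagier, from PRINTED facts.**
`W` globally minimal, `p` odd, `PotMult W p`: from `hCyc`, `h73`, `hWald`, `hmodN`, modularity, GZK and
Delbourgo 2002 (M) (`hDelM`, for (A)-torsion): `∃ Dh, LeadingTermClauses W p Dh ∧
BranchPAdicGrossZagierMultAt W p Dh` — the identity for EVERY admissible `(V, C, f, B, ϖ)`: §1 gives it at
each tuple for the tuple's own (B)-datum, REGULATOR RIGIDITY moves it to the fixed datum. GZ-H applies.
[cite: Disegni2017, Theorem A/B, (1.1.3), Rem. 1.3.2] [cite: Delbourgo2002, Theorem (A), (B) (p. 40)]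
[cite: GrossZagier1986, Thm. I.(7.3)] [cite: MazurTateTeitelbaum1986Invent, §I.10, §I.13–I.14, §II.4] -/
theorem potMult_exists_leadingTermClauses_and_branchPAdicGrossZagierMultAt_of_cycLineFact
    [W.IsElliptic] [W.IsGloballyMinimal]
    (hCyc : delbourgoDatum_cycLineGrossZagier) (h73 : GrossZagier1986_thm_I_7_3)
    (hWald : waldspurger_exists_heegnerField_twist_ne_zero) (hmodN : exists_isNewformOf)
    (hmod : hasEntireLFunction_rat) (hmodD : nonempty_modularParametrizationData)
    (hGZK : rank_eq_analyticRank_of_analyticRank_le_one) (hDelM : Delbourgo2002.mainTheorem_potMult)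
    (hpm : Summit.BirchSwinnertonDyer.Rank1Residual.AdditivePotMult.PotMult W p) (hp2 : p ≠ 2)
    (hr : W.analyticRank = 1) :
    ∃ Dh : PAdicHeightData W p, LeadingTermClauses W p Dh ∧ BranchPAdicGrossZagierMultAt W p Dh := by
  have hmw : W.mordellWeilRank = 1 := by rw [(hGZK W (by rw [hr])).1, hr]
  haveI : Finite W.sha := (hGZK W (by rw [hr])).2
  have hfin : Finite (AddCommGroup.primaryComponent W.sha p) := inferInstance
  have hA := (hpm.delbourgo2002 hDelM hp2).1
  -- a fixed datum, from one twist model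
  obtain ⟨V₀, iV₀, iV₀m, C₀, hV₀, hC₀⟩ := hpm.exists_mult_pStar_twist_model hp2
  haveI : NeZero (V₀.conductorNorm ℤ) := ⟨(V₀.conductorNorm_pos_holds).ne'⟩
  obtain ⟨Dm₀⟩ := hmodD V₀
  obtain ⟨ϖ₀, hϖ₀⟩ := exists_periodRatio_parity (p := p) V₀ Dm₀
  obtain ⟨B₀, hVB₀⟩ : ∃ B₀ : PowerSeries ℚ_[p],
      (V₀.HasSplitMultiplicativeReductionAtPrime p ∧
          B₀ = if Even (p / 2) then padicLFunctionPlusBranchMult Dm₀.f (1 : ℚ_[p]) (p / 2)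
            else padicLFunctionMinusBranchMult Dm₀.f (1 : ℚ_[p]) (p / 2)) ∨
        (V₀.HasMultiplicativeReductionAtPrime p ∧ ¬ V₀.HasSplitMultiplicativeReductionAtPrime p ∧
          B₀ = if Even (p / 2) then padicLFunctionPlusBranchMult Dm₀.f (-1 : ℚ_[p]) (p / 2)
            else padicLFunctionMinusBranchMult Dm₀.f (-1 : ℚ_[p]) (p / 2)) := by
    by_cases hs : V₀.HasSplitMultiplicativeReductionAtPrime p
    · exact ⟨_, Or.inl ⟨hs, rfl⟩⟩
    · exact ⟨_, Or.inr ⟨hV₀, hs, rfl⟩⟩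
  obtain ⟨Dh₀, -, -, hB₀, -, -⟩ :=
    potMult_exists_leadingTermClauses_and_identity_of_cycLineFact hCyc h73 hWald hmodN hmod hmodD hGZK hpm
      hp2 hr V₀ C₀ hC₀ Dm₀.isNewformOf B₀ hVB₀ ϖ₀ hϖ₀
  refine ⟨Dh₀, hB₀, ?_⟩
  -- every admissible tuple: its own datum, then rigidity
  intro V _ _ N _ f B hp2' hVW hVB hf ϖ hϖ
  obtain ⟨C, hC⟩ := hVW
  obtain ⟨Dh₁, u, q, hB₁, hlead, hid⟩ :=
    potMult_exists_leadingTermClauses_and_identity_of_cycLineFact hCyc h73 hWald hmodN hmod hmodD hGZK hpm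
      hp2 hr V C hC hf B hVB ϖ hϖ
  obtain ⟨v, hv⟩ := exists_unit_padicRegulator_eq_of_leadingTermClauses hA hfin hpm.reductionNonAnomalous
    hB₀ hB₁
  refine ⟨u * v, q, hlead, ?_⟩
  rw [hmw, pow_one, hid, hv, Units.val_mul, PadicInt.coe_mul]
  ring

/-- **(M), `r_an = 1`: the typed (M) `p`-adic Gross–Zagier for EVERY (B)-datum, from PRINTED facts**
(§2 + `potMult_branchPAdicGrossZagierMultAt_of_one_datum`). [cite: Disegni2017, Theorem A/B, (1.1.3), Rem. 1.3.2]
[cite: Delbourgo2002, Theorem (A), (B) (p. 40)] [cite: GrossZagier1986, Thm. I.(7.3)] -/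
theorem potMult_forall_branchPAdicGrossZagierMultAt_of_cycLineFact [W.IsElliptic] [W.IsGloballyMinimal]
    (hCyc : delbourgoDatum_cycLineGrossZagier) (h73 : GrossZagier1986_thm_I_7_3)
    (hWald : waldspurger_exists_heegnerField_twist_ne_zero) (hmodN : exists_isNewformOf)
    (hmod : hasEntireLFunction_rat) (hmodD : nonempty_modularParametrizationData)
    (hGZK : rank_eq_analyticRank_of_analyticRank_le_one) (hDelM : Delbourgo2002.mainTheorem_potMult)
    (hpm : Summit.BirchSwinnertonDyer.Rank1Residual.AdditivePotMult.PotMult W p) (hp2 : p ≠ 2)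
    (hr : W.analyticRank = 1) (Dh : PAdicHeightData W p) (hB : LeadingTermClauses W p Dh) :
    BranchPAdicGrossZagierMultAt W p Dh := by
  obtain ⟨Dh₀, hB₀, hGZ₀⟩ :=
    potMult_exists_leadingTermClauses_and_branchPAdicGrossZagierMultAt_of_cycLineFact hCyc h73 hWald hmodN
      hmod hmodD hGZK hDelM hpm hp2 hr
  exact potMult_branchPAdicGrossZagierMultAt_of_one_datum hDelM hGZK hpm hp2 (by rw [hr]) hB₀ hGZ₀ hB

/-! ### §3 Items 19592 and 19591 BY NAME from PRINTED facts (+ the class certificate); the §C v4 glue -/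

/-- **ITEM 19592 `MultBranchPAdicGrossZagierAt` BY NAME from PRINTED named facts** — Disegni's conjoined
fact (B) `hCyc`, Gross–Zagier I.(7.3) `h73`, Waldspurger `hWald`, modularity (`hmodN`, `hmod`, `hmodD`),
GZK, Delbourgo 2002 (M): for every rank-1 pair of cell (M) and EVERY height datum with Delbourgo's
clauses, `BranchPAdicGrossZagierMultAt W p Dh`. No certificate, no image hypothesis, `p = 3` included;
GZ-H applies. Conditional on the displayed named facts; nothing booked.
[cite: Disegni2017, Theorem A/B, (1.1.3), Rem. 1.3.2] [cite: Delbourgo2002, Theorem (A), (B) (p. 40), Hypothesis (p. 39)]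
[cite: GrossZagier1986, Thm. I.(7.3)] [cite: MazurTateTeitelbaum1986Invent, §I.10, §I.13–I.14] -/
theorem multBranchPAdicGrossZagierAt_of_cycLineFact
    (hCyc : delbourgoDatum_cycLineGrossZagier) (h73 : GrossZagier1986_thm_I_7_3)
    (hWald : waldspurger_exists_heegnerField_twist_ne_zero) (hmodN : exists_isNewformOf)
    (hmod : hasEntireLFunction_rat) (hmodD : nonempty_modularParametrizationData)
    (hGZK : rank_eq_analyticRank_of_analyticRank_le_one) (hDelM : Delbourgo2002.mainTheorem_potMult) :
    MultBranchPAdicGrossZagierAt := by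
  intro W _ _ p _ hcM hr Dh hB
  have hpm : Summit.BirchSwinnertonDyer.Rank1Residual.AdditivePotMult.PotMult W p := ⟨hcM.2.1, hcM.2.2⟩
  exact potMult_forall_branchPAdicGrossZagierMultAt_of_cycLineFact hCyc h73 hWald hmodN hmod hmodD hGZK
    hDelM hpm hcM.1 hr Dh hB

/-- **Schneider from the typed (M) `p`-adic Gross–Zagier at ONE datum and the census bit.** For `W` of
analytic rank one with `BranchPAdicGrossZagierMultAt W p Dh` and a multiplicative twist model
`C • V^{(p*)} = W`: if on every twist datum the linear coefficient of `ϖ·L^±_p(f_V, a_p, ω^{(p−1)/2}, T)` is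
non-zero (the census-literal bit `hne`, `A′ ≠ 0`), then `Reg_p(E,Dh) ≠ 0` (`ϖ·[T¹]B·log_p γ = u·q·Reg_p`
with `ϖ·[T¹]B ≠ 0`, `log_p γ ≠ 0`). [cite: MazurTateTeitelbaum1986Invent, §I.13–I.14]
[cite: Schneider1985, Thm. 2′ (shape; nothing asserted)] -/
theorem schneiderConjecture_of_branchPAdicGrossZagierMultAt_of_multCoeffOneNeZero [W.IsElliptic]
    [W.IsGloballyMinimal] (hp2 : p ≠ 2) (hmodD : nonempty_modularParametrizationData)
    (hGZK : rank_eq_analyticRank_of_analyticRank_le_one) (hr : W.analyticRank = 1)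
    {Dh : PAdicHeightData W p} (hGZ : BranchPAdicGrossZagierMultAt W p Dh)
    (hne : ∀ (V : WeierstrassCurve ℚ) [V.IsElliptic] [V.IsGloballyMinimal] (C : VariableChange ℚ),
      Mult V p → C • V.quadraticTwist ((-1 : ℚ) ^ (p / 2) * p) = W →
      ∀ {N : ℕ} [NeZero N] (f : CuspForm (Gamma0 N) 2), IsNewformOf V f → ∀ (ap : ℤ), cuspCoeff f p = ap →
      ∀ ϖ : ℚ, (if Even (p / 2) then (ϖ : ℝ) * V.realPeriodRat = plusPeriod f
          else (ϖ : ℝ) * V.imaginaryPeriodRat = minusPeriod f) →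
        PowerSeries.coeff 1 (PowerSeries.C (ϖ : ℚ_[p]) *
            (if Even (p / 2) then padicLFunctionPlusBranchMult f (ap : ℚ_[p]) (p / 2)
              else padicLFunctionMinusBranchMult f (ap : ℚ_[p]) (p / 2))) ≠ 0)
    (V : WeierstrassCurve ℚ) [V.IsElliptic] [V.IsGloballyMinimal]
    (C : VariableChange ℚ) (hV : Mult V p) (hC : C • V.quadraticTwist ((-1 : ℚ) ^ (p / 2) * p) = W) :
    SchneiderConjecture Dh := by
  have hmw : W.mordellWeilRank = 1 := by rw [(hGZK W (by rw [hr])).1, hr]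
  haveI : NeZero (V.conductorNorm ℤ) := ⟨(V.conductorNorm_pos_holds).ne'⟩
  obtain ⟨Dm⟩ := hmodD V
  obtain ⟨ϖ, hϖ⟩ := exists_periodRatio_parity (p := p) V Dm
  obtain ⟨B, hVB⟩ : ∃ B : PowerSeries ℚ_[p],
      (V.HasSplitMultiplicativeReductionAtPrime p ∧
          B = if Even (p / 2) then padicLFunctionPlusBranchMult Dm.f (1 : ℚ_[p]) (p / 2)
            else padicLFunctionMinusBranchMult Dm.f (1 : ℚ_[p]) (p / 2)) ∨
        (V.HasMultiplicativeReductionAtPrime p ∧ ¬ V.HasSplitMultiplicativeReductionAtPrime p ∧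
          B = if Even (p / 2) then padicLFunctionPlusBranchMult Dm.f (-1 : ℚ_[p]) (p / 2)
            else padicLFunctionMinusBranchMult Dm.f (-1 : ℚ_[p]) (p / 2)) := by
    by_cases hs : V.HasSplitMultiplicativeReductionAtPrime p
    · exact ⟨_, Or.inl ⟨hs, rfl⟩⟩
    · exact ⟨_, Or.inr ⟨hV, hs, rfl⟩⟩
  obtain ⟨-, hBeq⟩ := multBranch_eq_ite_of_disj V Dm.isNewformOf hVB
  obtain ⟨u, q, -, hid⟩ := hGZ V B hp2 ⟨C, hC⟩ hVB Dm.isNewformOf ϖ hϖ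
  rw [hmw, pow_one, hBeq] at hid
  have h1 := hne V C hV hC Dm.f Dm.isNewformOf (V.LFunction p) (Dm.isNewformOf.2 p) ϖ hϖ
  rw [PowerSeries.coeff_C_mul] at h1
  exact padicRegulator_ne_zero_of_twisted_identity hp2 h1 hid

/-- **ITEM 19591 `MultSchneiderNondegeneracy` BY NAME from PRINTED facts and the (M) class certificate**
(`hCyc`, `h73`, `hWald`, `hmodN`, `hmod`, `hmodD`, GZK, `hDelM`; `hCert` = the census bit at every rank-1
(M) pair, cell hazard H3): for every (B)-datum of every rank-1 (M) pair, `Reg_p(E,Dh) ≠ 0` — the typed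
`p`-adic GZ at that datum (§3) + the bit at the multiplicative `p*`-twist model. NO image hypothesis;
`p = 3` included. Conditional; nothing booked. [cite: Disegni2017, Theorem A/B, Rem. 1.3.2]
[cite: Delbourgo2002, Theorem (A), (B) (p. 40)] [cite: Schneider1985, Thm. 2′ (shape; nothing asserted)] -/
theorem multSchneiderNondegeneracy_of_cycLineFact_of_classCert
    (hCyc : delbourgoDatum_cycLineGrossZagier) (h73 : GrossZagier1986_thm_I_7_3)
    (hWald : waldspurger_exists_heegnerField_twist_ne_zero) (hmodN : exists_isNewformOf)
    (hmod : hasEntireLFunction_rat) (hmodD : nonempty_modularParametrizationData)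
    (hGZK : rank_eq_analyticRank_of_analyticRank_le_one) (hDelM : Delbourgo2002.mainTheorem_potMult)
    (hCert : ∀ (W : WeierstrassCurve ℚ) [W.IsElliptic] [W.IsGloballyMinimal] (p : ℕ) [Fact p.Prime],
      N10.CellM W p → W.analyticRank = 1 →
      ∀ (V : WeierstrassCurve ℚ) [V.IsElliptic] [V.IsGloballyMinimal] (C : VariableChange ℚ),
        Mult V p → C • V.quadraticTwist ((-1 : ℚ) ^ (p / 2) * p) = W →
        ∀ {N : ℕ} [NeZero N] (f : CuspForm (Gamma0 N) 2), IsNewformOf V f → ∀ (ap : ℤ), cuspCoeff f p = ap →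
        ∀ ϖ : ℚ, (if Even (p / 2) then (ϖ : ℝ) * V.realPeriodRat = plusPeriod f
            else (ϖ : ℝ) * V.imaginaryPeriodRat = minusPeriod f) →
          PowerSeries.coeff 1 (PowerSeries.C (ϖ : ℚ_[p]) *
              (if Even (p / 2) then padicLFunctionPlusBranchMult f (ap : ℚ_[p]) (p / 2)
                else padicLFunctionMinusBranchMult f (ap : ℚ_[p]) (p / 2))) ≠ 0) :
    MultSchneiderNondegeneracy := by
  intro W _ _ p _ hcM hr Dh hB
  have hpm : Summit.BirchSwinnertonDyer.Rank1Residual.AdditivePotMult.PotMult W p := ⟨hcM.2.1, hcM.2.2⟩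
  obtain ⟨V, iV, iVm, C, hV, hC⟩ := hpm.exists_mult_pStar_twist_model hcM.1
  exact schneiderConjecture_of_branchPAdicGrossZagierMultAt_of_multCoeffOneNeZero hcM.1 hmodD hGZK hr
    (potMult_forall_branchPAdicGrossZagierMultAt_of_cycLineFact hCyc h73 hWald hmodN hmod hmodD hGZK hDelM
      hpm hcM.1 hr Dh hB) (hCert W p hcM hr) V C hV hC

/-- **§C v4 GLUE for crux 19359 — hFact replaced by PRINT.** `MultLower` BY NAME from: the four HELD leaves
of the v2 split (`DelbourgoPotMultUnit`, `PalQuadraticTwistPeriod`, `DelbourgoLeadingTermPotMult`,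
`MultModularityInputs` = GZK ∧ modularity ∧ `hmodD`), FOUR more by-name PRINTED inputs — Disegni's conjoined
fact (B) `hCyc` (the 19480-shaped leaf `DisegniDelbourgoCycLineGrossZagier` of crux 19358, whose (M) clause
is consumed here), Gross–Zagier 1986 I.(7.3) `h73` (19369), Waldspurger `hWald` (19571), `exists_isNewformOf`
`hmodN` (19382) —, the Λ-adic content crux `MultLambdaLower` (19590, verbatim) and the (M) CLASS
CERTIFICATE. 19591/19592 DERIVED (§3) and fed to the landed v2 glue `multLowerOfParts_proof` (p437547).
Conditional; cell (M) stays CONSTRUCTION-shaped; nothing booked.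
[cite: Delbourgo1998, Prop. 4, §2.2 Lemma (ii), Main Conjecture (p. 151) (shape)] [cite: Delbourgo2002, Theorem (A), (B) (p. 40)]
[cite: Disegni2017, Theorem A/B, (1.1.3), Rem. 1.3.2] [cite: GrossZagier1986, Thm. I.(7.3)] [cite: Pal2012, Thm. 3.2]
[cite: Miller2011LMS, Def. 1.1] -/
theorem multLower_of_facts_of_cycLineFact_of_multLambdaLower_of_classCert
    (h1 : DelbourgoPotMultUnit) (h2 : PalQuadraticTwistPeriod) (h3 : DelbourgoLeadingTermPotMult)
    (h4 : MultModularityInputs) (hCyc : delbourgoDatum_cycLineGrossZagier) (h73 : GrossZagier1986_thm_I_7_3)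
    (hWald : waldspurger_exists_heegnerField_twist_ne_zero) (hmodN : exists_isNewformOf)
    (hΛ : MultLambdaLower)
    (hCert : ∀ (W : WeierstrassCurve ℚ) [W.IsElliptic] [W.IsGloballyMinimal] (p : ℕ) [Fact p.Prime],
      N10.CellM W p → W.analyticRank = 1 →
      ∀ (V : WeierstrassCurve ℚ) [V.IsElliptic] [V.IsGloballyMinimal] (C : VariableChange ℚ),
        Mult V p → C • V.quadraticTwist ((-1 : ℚ) ^ (p / 2) * p) = W →
        ∀ {N : ℕ} [NeZero N] (f : CuspForm (Gamma0 N) 2), IsNewformOf V f → ∀ (ap : ℤ), cuspCoeff f p = ap →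
        ∀ ϖ : ℚ, (if Even (p / 2) then (ϖ : ℝ) * V.realPeriodRat = plusPeriod f
            else (ϖ : ℝ) * V.imaginaryPeriodRat = minusPeriod f) →
          PowerSeries.coeff 1 (PowerSeries.C (ϖ : ℚ_[p]) *
              (if Even (p / 2) then padicLFunctionPlusBranchMult f (ap : ℚ_[p]) (p / 2)
                else padicLFunctionMinusBranchMult f (ap : ℚ_[p]) (p / 2))) ≠ 0) :
    MultLower :=
  multLowerOfParts_proof h1 h2 h3 h4 hΛ
    (multSchneiderNondegeneracy_of_cycLineFact_of_classCert hCyc h73 hWald hmodN h4.2.1 h4.2.2 h4.1 h3 hCert)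
    (multBranchPAdicGrossZagierAt_of_cycLineFact hCyc h73 hWald hmodN h4.2.1 h4.2.2 h4.1 h3)

end Summit.BirchSwinnertonDyer.BirchSwinnertonDyer.Theorems.AdditiveBranchIMCMultLower

end
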